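import Mathlib
import HarnessLib
import Summits.HubbardSuperconductivity.HubbardSuperconductivity.Theorems.ThermalWedgeTwPureThermalBoundDensityLimitC

/-!
# Route `ThermalWedge`, item `stmt-HubbardSuperconductivity-1702` (`TwPureThermalBound`):
# the abstract real analysis of the thermodynamic limit of sector energies — part D (uniformity, supporting
# line, and the ground-energy ensemble-equivalence form)

Support file (`--supports stmt-HubbardSuperconductivity-1702`; pure real analysis, no definition). With the
hypotheses of parts B–C on `E : ℕ → ℕ → ℝ` and `e(ν) = inf_{M ≥ 2}(E M ⌊νM²⌋/M² + (2C+T)/M)`: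
* `ptb_uniform_sectorDensity` — UNIFORM convergence `sup_{4K ≤ 5L²} |E L K/L² − e(K/L²)| → 0` (finite
  density grid, two-sided Lipschitz in `K`, Lipschitz of `e`);
* `ptb_exists_supportingLine` — a convex function on `[0, 5/4]` has a supporting line at every interior
  point, with slope between the left and the right chords (generic);
* `ptb_gsee_of_supportingLine` — **the `T = 0` ensemble-equivalence form**: if `μ ≤ 0` supports `e` at
  `n ∈ (0, 1]`, `|N_L − nL²| ≤ 2`, and (refl) `E L (2L²−K) ≤ E L K + R(L+1)` for `K ≥ L²` (particle–hole
  on the box + torus/box comparison in the application), then for every `ε > 0`, eventually in `L`,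
  `E L N_L − μN_L ≤ E L K − μK + εL²` for ALL `K ≤ 2L²` — exactly the hypothesis (GSEE) of
  `twPureThermalBound_of_gsee` (`ThermalWedgeTwPureThermalBoundReduction.lean`) once `E`, `μ` are
  instantiated. Folklore (Ruelle 1969 §3: equivalence of ensembles via convexity).
-/

set_option linter.dupNamespace false

noncomputable section

namespace Summit.HubbardSuperconductivity.HubbardSuperconductivity.Theorems

open Filter Set Finset
open scoped Topology BigOperators

/-! ### A supporting line of a convex function of one variable -/

/-- **Supporting line at an interior point.** For `f` convex on `[0, 5/4]` and `0 < n < 5/4` there is a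
slope `μ` (the supremum of the left chords) with `f n + μ(ν − n) ≤ f ν` on `[0, 5/4]`; moreover `μ`
dominates every left chord and is dominated by every right chord. [folklore] -/
theorem ptb_exists_supportingLine {f : ℝ → ℝ} (hf : ConvexOn ℝ (Icc (0 : ℝ) (5 / 4)) f) {n : ℝ}
    (hn0 : 0 < n) (hn1 : n < 5 / 4) :
    ∃ μ : ℝ, (∀ ν ∈ Icc (0 : ℝ) (5 / 4), f n + μ * (ν - n) ≤ f ν) ∧
      (∀ x ∈ Icc (0 : ℝ) (5 / 4), x < n → (f n - f x) / (n - x) ≤ μ) ∧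
      (∀ y ∈ Icc (0 : ℝ) (5 / 4), n < y → μ ≤ (f y - f n) / (y - n)) := by
  have hnmem : n ∈ Icc (0 : ℝ) (5 / 4) := ⟨hn0.le, hn1.le⟩
  set S : Set ℝ := (fun x => (f n - f x) / (n - x)) '' {x | x ∈ Icc (0 : ℝ) (5 / 4) ∧ x < n} with hS
  have hSne : S.Nonempty := ⟨_, 0, ⟨⟨le_rfl, by norm_num⟩, hn0⟩, rfl⟩
  -- every right chord bounds `S` above
  have hub : ∀ y ∈ Icc (0 : ℝ) (5 / 4), n < y → ∀ s ∈ S, s ≤ (f y - f n) / (y - n) := by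
    rintro y hy hny _ ⟨x, ⟨hx, hxn⟩, rfl⟩
    exact hf.slope_mono_adjacent hx hy hxn hny
  have hy₀ : (5 / 4 : ℝ) ∈ Icc (0 : ℝ) (5 / 4) := ⟨by norm_num, le_rfl⟩
  have hSbdd : BddAbove S := ⟨_, fun s hs => hub (5 / 4) hy₀ hn1 s hs⟩
  refine ⟨sSup S, ?_, ?_, ?_⟩
  · intro ν hν
    rcases lt_trichotomy ν n with hlt | rfl | hgt
    · have hle : (f n - f ν) / (n - ν) ≤ sSup S := le_csSup hSbdd ⟨ν, ⟨hν, hlt⟩, rfl⟩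
      rw [div_le_iff₀ (by linarith)] at hle
      nlinarith
    · simp
    · have hle : sSup S ≤ (f ν - f n) / (ν - n) := csSup_le hSne (hub ν hν hgt)
      rw [le_div_iff₀ (by linarith)] at hle
      linarith
  · intro x hx hxn
    exact le_csSup hSbdd ⟨x, ⟨hx, hxn⟩, rfl⟩
  · intro y hy hny
    exact csSup_le hSne (hub y hy hny)

section Abstract

variable {E : ℕ → ℕ → ℝ} {c C T F : ℝ}

/-! ### Uniform convergence of the sector energy densities -/

/-- **Uniform convergence**: `sup_{4K ≤ 5L²} |E L K / L² − e(K/L²)| → 0`. [folklore] -/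
theorem ptb_uniform_sectorDensity (hc : 0 ≤ c) (hC : 0 ≤ C) (hT : 0 ≤ T) (hF : 0 ≤ F)
    (hlow : ∀ L K : ℕ, K ≤ 2 * L ^ 2 → -(c * (L : ℝ) ^ 2) ≤ E L K)
    (hup : ∀ L K : ℕ, 2 * (K + 1) ≤ 3 * L ^ 2 → E L (K + 1) ≤ E L K + C)
    (hdn : ∀ L K : ℕ, 1 ≤ K → K ≤ 2 * L ^ 2 → E L (K - 1) ≤ E L K + C)
    (htile : ∀ (M k : ℕ) (Ns : Fin (k + 1) → Fin (k + 1) → ℕ), (∀ i j, Ns i j ≤ 2 * (M * M)) →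
      E ((k + 1) * M) (∑ i, ∑ j, Ns i j) ≤ ∑ i, ∑ j, E M (Ns i j) + T * M * k * (k + 1))
    (hfill : ∀ (ℓ r N NB : ℕ), N ≤ 2 * (ℓ * ℓ) → NB ≤ 2 * (r * ℓ + r * (ℓ + r)) →
      E (ℓ + r) (N + NB) ≤ E ℓ N + F * ((r * ℓ + r * (ℓ + r) : ℕ) + (2 * ℓ + r : ℕ)))
    {ε : ℝ} (hε : 0 < ε) :
    ∃ L₀ : ℕ, ∀ L : ℕ, L₀ ≤ L → ∀ K : ℕ, 4 * K ≤ 5 * L ^ 2 →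
      |E L K / (L : ℝ) ^ 2 -
        sInf ((fun M : ℕ => E M ⌊((K : ℝ) / (L : ℝ) ^ 2) * (M : ℝ) ^ 2⌋₊ / (M : ℝ) ^ 2 + (2 * C + T) / M) '' {M | 2 ≤ M})| ≤ ε := by
  set e : ℝ → ℝ := fun ν => sInf ((fun M : ℕ => E M ⌊ν * (M : ℝ) ^ 2⌋₊ / (M : ℝ) ^ 2 + (2 * C + T) / M) '' {M | 2 ≤ M})
    with he
  -- grid size `G` with `C/G ≤ ε/4`
  obtain ⟨G₀, hG₀⟩ := exists_nat_gt (4 * C / ε)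
  set G : ℕ := G₀ + 1 with hGdef
  have hG : 4 * C / ε < G := hG₀.trans (by rw [hGdef]; push_cast; linarith)
  have hG1 : 1 ≤ G := by rw [hGdef]; omega
  have hGpos : (0 : ℝ) < G := by exact_mod_cast hG1
  have hCG : C / G ≤ ε / 4 := by
    rw [div_le_iff₀ hGpos]
    rw [div_lt_iff₀ hε] at hG
    nlinarith
  -- grid points `i/G`, `i ≤ I`
  set I : ℕ := ⌊(5 / 4 : ℝ) * G⌋₊ with hI
  have hgrid : ∀ i : ℕ, i ≤ I → 0 ≤ (i : ℝ) / G ∧ (i : ℝ) / G ≤ 5 / 4 := fun i hi => by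
    refine ⟨by positivity, ?_⟩
    rw [div_le_iff₀ hGpos]
    have : (i : ℝ) ≤ I := by exact_mod_cast hi
    exact this.trans (Nat.floor_le (by positivity))
  -- pointwise convergence at the finitely many grid points, eventually within `ε/4`
  have hpt : ∀ i ∈ Finset.range (I + 1), ∀ᶠ L : ℕ in atTop,
      |E L ⌊(i : ℝ) / G * (L : ℝ) ^ 2⌋₊ / (L : ℝ) ^ 2 - e ((i : ℝ) / G)| < ε / 4 := by
    intro i hi
    have hi' : i ≤ I := Nat.lt_succ_iff.1 (Finset.mem_range.1 hi)
    have hlim := ptb_tendsto_sectorDensity hc hC hT hF hlow hup hdn htile hfill (hgrid i hi').1 (hgrid i hi').2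
    have := Metric.tendsto_nhds.1 hlim (ε / 4) (by positivity)
    simpa only [Real.dist_eq] using this
  have hall := (Filter.eventually_all_finset _).2 hpt
  -- large `L`: `C/L² ≤ ε/4` and `L ≥ 2`
  have hL2 : ∀ᶠ L : ℕ in atTop, C / (L : ℝ) ^ 2 ≤ ε / 4 ∧ 2 ≤ L := by
    have h1 : Tendsto (fun L : ℕ => C / (L : ℝ) ^ 2) atTop (𝓝 0) := by
      have : Tendsto (fun L : ℕ => (L : ℝ) ^ 2) atTop atTop :=
        (tendsto_pow_atTop two_ne_zero).comp tendsto_natCast_atTop_atTop |>.congr fun _ => rfl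
      exact tendsto_const_nhds.div_atTop this
    have h2 := (Metric.tendsto_nhds.1 h1 (ε / 4) (by positivity))
    filter_upwards [h2, eventually_ge_atTop 2] with L hL hL2
    rw [Real.dist_eq, sub_zero] at hL
    exact ⟨(le_abs_self _).trans hL.le, hL2⟩
  obtain ⟨L₀, hL₀⟩ := eventually_atTop.1 (hall.and hL2)
  refine ⟨L₀, fun L hL K hK => ?_⟩
  obtain ⟨hgridL, hCL, hL2'⟩ := hL₀ L hL
  have hLpos : (0 : ℝ) < (L : ℝ) ^ 2 := by
    have : (0 : ℝ) < L := by exact_mod_cast lt_of_lt_of_le zero_lt_two hL2'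
    positivity
  -- the density `ν = K/L²` and its grid point `i = ⌊νG⌋`
  set ν : ℝ := (K : ℝ) / (L : ℝ) ^ 2 with hν
  have hν0 : 0 ≤ ν := by positivity
  have hν1 : ν ≤ 5 / 4 := by
    rw [hν, div_le_iff₀ hLpos]
    have : (4 * K : ℝ) ≤ 5 * (L : ℝ) ^ 2 := by exact_mod_cast hK
    linarith
  set i : ℕ := ⌊ν * G⌋₊ with hi
  have hiI : i ≤ I := Nat.floor_le_floor (by nlinarith)
  have himem : i ∈ Finset.range (I + 1) := Finset.mem_range.2 (Nat.lt_succ_of_le hiI)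
  have hgi := hgrid i hiI
  have hνi : (i : ℝ) / G ≤ ν ∧ ν - (i : ℝ) / G ≤ 1 / G := by
    have a1 : (i : ℝ) ≤ ν * G := Nat.floor_le (by positivity)
    have a2 : ν * G < i + 1 := Nat.lt_floor_add_one _
    constructor
    · rw [div_le_iff₀ hGpos]; exact a1
    · rw [sub_le_iff_le_add, ← add_div, le_div_iff₀ hGpos]; linarith
  -- term 2: grid point convergence
  have h2 := hgridL i himem
  -- term 3: Lipschitz of `e`
  have h3 := ptb_abs_eLim_sub_le hc hC hT hF hlow hup hdn htile hfill hgi.1 hgi.2 hν0 hν1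
  change |e ((i : ℝ) / G) - e ν| ≤ C * |(i : ℝ) / G - ν| at h3
  have h3' : |e ((i : ℝ) / G) - e ν| ≤ ε / 4 := by
    refine h3.trans ?_
    rw [abs_sub_comm, abs_of_nonneg (by linarith [hνi.1])]
    calc C * (ν - (i : ℝ) / G) ≤ C * (1 / G) := mul_le_mul_of_nonneg_left hνi.2 hC
      _ = C / G := by ring
      _ ≤ ε / 4 := hCG
  -- term 1: finite-volume Lipschitz between `K` and `⌊(i/G)L²⌋`
  have hKfl : 2 * K ≤ 3 * L ^ 2 := by omega
  have hifl : 2 * ⌊(i : ℝ) / G * (L : ℝ) ^ 2⌋₊ ≤ 3 * L ^ 2 := by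
    have := ptb_two_floor_succ_le hgi.1 hgi.2 hL2'; omega
  have h1 := ptb_abs_E_sub_E_le hup hdn L K _ hKfl hifl
  have h1' : |E L K / (L : ℝ) ^ 2 - E L ⌊(i : ℝ) / G * (L : ℝ) ^ 2⌋₊ / (L : ℝ) ^ 2| ≤ ε / 4 + ε / 4 := by
    rw [← sub_div, abs_div, abs_of_pos hLpos, div_le_iff₀ hLpos]
    refine h1.trans ?_
    have hfl1 : (⌊(i : ℝ) / G * (L : ℝ) ^ 2⌋₊ : ℝ) ≤ (i : ℝ) / G * (L : ℝ) ^ 2 := Nat.floor_le (by positivity)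
    have hfl2 : (i : ℝ) / G * (L : ℝ) ^ 2 < ⌊(i : ℝ) / G * (L : ℝ) ^ 2⌋₊ + 1 := Nat.lt_floor_add_one _
    have hKν : (K : ℝ) = ν * (L : ℝ) ^ 2 := by rw [hν]; field_simp
    have hdiff : |(K : ℝ) - ⌊(i : ℝ) / G * (L : ℝ) ^ 2⌋₊| ≤ (1 / G) * (L : ℝ) ^ 2 + 1 := by
      rw [abs_le, hKν]
      have b1 : (ν - (i : ℝ) / G) * (L : ℝ) ^ 2 ≤ (1 / G) * (L : ℝ) ^ 2 := mul_le_mul_of_nonneg_right hνi.2 hLpos.le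
      have b2 : 0 ≤ (ν - (i : ℝ) / G) * (L : ℝ) ^ 2 := mul_nonneg (by linarith [hνi.1]) hLpos.le
      constructor <;> nlinarith
    have := mul_le_mul_of_nonneg_left hdiff hC
    have e1 : C * (1 / G * (L : ℝ) ^ 2 + 1) = (C / G + C / (L : ℝ) ^ 2) * (L : ℝ) ^ 2 := by field_simp
    rw [e1] at this
    have e2 : (C / G + C / (L : ℝ) ^ 2) * (L : ℝ) ^ 2 ≤ (ε / 4 + ε / 4) * (L : ℝ) ^ 2 :=
      mul_le_mul_of_nonneg_right (add_le_add hCG hCL) hLpos.le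
    linarith
  -- combine
  have htri : |E L K / (L : ℝ) ^ 2 - e ν| ≤ |E L K / (L : ℝ) ^ 2 - E L ⌊(i : ℝ) / G * (L : ℝ) ^ 2⌋₊ / (L : ℝ) ^ 2| +
      |E L ⌊(i : ℝ) / G * (L : ℝ) ^ 2⌋₊ / (L : ℝ) ^ 2 - e ((i : ℝ) / G)| + |e ((i : ℝ) / G) - e ν| := by
    have := abs_sub_le (E L K / (L : ℝ) ^ 2) (E L ⌊(i : ℝ) / G * (L : ℝ) ^ 2⌋₊ / (L : ℝ) ^ 2) (e ν)
    have := abs_sub_le (E L ⌊(i : ℝ) / G * (L : ℝ) ^ 2⌋₊ / (L : ℝ) ^ 2) (e ((i : ℝ) / G)) (e ν)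
    linarith
  change |E L K / (L : ℝ) ^ 2 - e ν| ≤ ε
  linarith [h2.le]

/-! ### The ensemble-equivalence form -/

/-- **GSEE form.** Under the hypotheses of parts B–C, (refl), a slope `μ ≤ 0` supporting `e` at
`n ∈ (0, 1]` over `[0, 5/4]`, and a particle-number sequence with `|N_L − nL²| ≤ 2`: for every `ε > 0`,
eventually in `L`, `E L N_L − μ N_L ≤ E L K − μK + εL²` for all `K ≤ 2L²`. [folklore] -/
theorem ptb_gsee_of_supportingLine (hc : 0 ≤ c) (hC : 0 ≤ C) (hT : 0 ≤ T) (hF : 0 ≤ F) {R : ℝ} (hR : 0 ≤ R)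
    (hlow : ∀ L K : ℕ, K ≤ 2 * L ^ 2 → -(c * (L : ℝ) ^ 2) ≤ E L K)
    (hup : ∀ L K : ℕ, 2 * (K + 1) ≤ 3 * L ^ 2 → E L (K + 1) ≤ E L K + C)
    (hdn : ∀ L K : ℕ, 1 ≤ K → K ≤ 2 * L ^ 2 → E L (K - 1) ≤ E L K + C)
    (htile : ∀ (M k : ℕ) (Ns : Fin (k + 1) → Fin (k + 1) → ℕ), (∀ i j, Ns i j ≤ 2 * (M * M)) →
      E ((k + 1) * M) (∑ i, ∑ j, Ns i j) ≤ ∑ i, ∑ j, E M (Ns i j) + T * M * k * (k + 1))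
    (hfill : ∀ (ℓ r N NB : ℕ), N ≤ 2 * (ℓ * ℓ) → NB ≤ 2 * (r * ℓ + r * (ℓ + r)) →
      E (ℓ + r) (N + NB) ≤ E ℓ N + F * ((r * ℓ + r * (ℓ + r) : ℕ) + (2 * ℓ + r : ℕ)))
    (hrefl : ∀ L K : ℕ, L ^ 2 ≤ K → K ≤ 2 * L ^ 2 → E L (2 * L ^ 2 - K) ≤ E L K + R * ((L : ℝ) + 1))
    {n μ : ℝ} (hn0 : 0 < n) (hn1 : n ≤ 1) (hμ : μ ≤ 0)
    (hsupp : ∀ ν ∈ Icc (0 : ℝ) (5 / 4),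
      sInf ((fun M : ℕ => E M ⌊n * (M : ℝ) ^ 2⌋₊ / (M : ℝ) ^ 2 + (2 * C + T) / M) '' {M | 2 ≤ M}) + μ * (ν - n) ≤
        sInf ((fun M : ℕ => E M ⌊ν * (M : ℝ) ^ 2⌋₊ / (M : ℝ) ^ 2 + (2 * C + T) / M) '' {M | 2 ≤ M}))
    {NL : ℕ → ℕ} (hNL : ∀ L : ℕ, |(NL L : ℝ) - n * (L : ℝ) ^ 2| ≤ 2)
    {ε : ℝ} (hε : 0 < ε) :
    ∃ L₀ : ℕ, ∀ L : ℕ, L₀ ≤ L → ∀ K : ℕ, K ≤ 2 * L ^ 2 →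
      E L (NL L) - μ * (NL L) ≤ E L K - μ * K + ε * (L : ℝ) ^ 2 := by
  set e : ℝ → ℝ := fun ν => sInf ((fun M : ℕ => E M ⌊ν * (M : ℝ) ^ 2⌋₊ / (M : ℝ) ^ 2 + (2 * C + T) / M) '' {M | 2 ≤ M})
    with he
  have hε4 : 0 < ε / 4 := by positivity
  obtain ⟨L₁, hL₁⟩ := ptb_uniform_sectorDensity hc hC hT hF hlow hup hdn htile hfill hε4
  -- large `L`: the `O(1)` and `O(L)` errors are `≤ (ε/4) L²`
  obtain ⟨L₂, hL₂⟩ := exists_nat_gt (max 4 ((2 * |μ| + 2 * C + 2 * R + 8) / (ε / 4)))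
  refine ⟨max L₁ L₂, fun L hL K hK => ?_⟩
  have hLL₁ : L₁ ≤ L := le_trans (le_max_left _ _) hL
  have hLL₂ : (L₂ : ℝ) ≤ L := by exact_mod_cast le_trans (le_max_right _ _) hL
  have hL4 : (4 : ℝ) < L := lt_of_le_of_lt (le_max_left _ _) (hL₂.trans_le hLL₂)
  have hLpos : (0 : ℝ) < L := by linarith
  have hL2pos : (0 : ℝ) < (L : ℝ) ^ 2 := by positivity
  have hsmall : 2 * |μ| + 2 * C + 2 * R + 8 + R * ((L : ℝ) + 1) ≤ ε / 4 * (L : ℝ) ^ 2 + ε / 4 * (L : ℝ) ^ 2 := by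
    set A : ℝ := 2 * |μ| + 2 * C + 2 * R + 8 with hAdef
    have hA0 : 0 ≤ A := by rw [hAdef]; positivity
    have h1 : A / (ε / 4) < L := lt_of_le_of_lt (le_max_right _ _) (hL₂.trans_le hLL₂)
    rw [div_lt_iff₀ hε4] at h1
    have hL1 : (1 : ℝ) ≤ L := by linarith
    have h1' : A * L < (L : ℝ) * (ε / 4) * L := mul_lt_mul_of_pos_right h1 hLpos
    have hAL : A ≤ A * L := le_mul_of_one_le_right hA0 hL1
    have h2R : 2 * R ≤ A := by rw [hAdef]; linarith [abs_nonneg μ]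
    have hRL : R * ((L : ℝ) + 1) ≤ 2 * R * L := by nlinarith
    have h2RL : 2 * R * L ≤ A * L := mul_le_mul_of_nonneg_right h2R hLpos.le
    have hsq : (L : ℝ) * (ε / 4) * L = ε / 4 * (L : ℝ) ^ 2 := by ring
    linarith
  -- the left-hand side: `E L N_L ≤ L² e(n) + 2C + (ε/4)L²`
  have hNLr := hNL L
  have hNL1 : 4 * NL L ≤ 5 * L ^ 2 := by
    have : (NL L : ℝ) ≤ n * (L : ℝ) ^ 2 + 2 := by linarith [(abs_le.1 hNLr).2]
    have : (4 * NL L : ℝ) ≤ 5 * (L : ℝ) ^ 2 := by nlinarith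
    exact_mod_cast this
  have hA := hL₁ L hLL₁ (NL L) hNL1
  have hνN0 : 0 ≤ (NL L : ℝ) / (L : ℝ) ^ 2 := by positivity
  have hνN1 : (NL L : ℝ) / (L : ℝ) ^ 2 ≤ 5 / 4 := by
    rw [div_le_iff₀ hL2pos]; have : (4 * NL L : ℝ) ≤ 5 * (L : ℝ) ^ 2 := by exact_mod_cast hNL1
    linarith
  have hn54 : n ≤ 5 / 4 := by linarith
  have hLipN := ptb_abs_eLim_sub_le hc hC hT hF hlow hup hdn htile hfill hνN0 hνN1 hn0.le hn54
  change |e ((NL L : ℝ) / (L : ℝ) ^ 2) - e n| ≤ C * |(NL L : ℝ) / (L : ℝ) ^ 2 - n| at hLipN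
  have hdistN : |(NL L : ℝ) / (L : ℝ) ^ 2 - n| ≤ 2 / (L : ℝ) ^ 2 := by
    rw [show (NL L : ℝ) / (L : ℝ) ^ 2 - n = ((NL L : ℝ) - n * (L : ℝ) ^ 2) / (L : ℝ) ^ 2 by field_simp, abs_div,
      abs_of_pos hL2pos]
    exact div_le_div_of_nonneg_right hNLr hL2pos.le
  have hLHS : E L (NL L) ≤ (L : ℝ) ^ 2 * e n + 2 * C + ε / 4 * (L : ℝ) ^ 2 := by
    have a1 := (abs_le.1 hA).2
    change E L (NL L) / (L : ℝ) ^ 2 - e ((NL L : ℝ) / (L : ℝ) ^ 2) ≤ ε / 4 at a1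
    have a2 := (abs_le.1 hLipN).2
    have a3 : C * |(NL L : ℝ) / (L : ℝ) ^ 2 - n| ≤ C * (2 / (L : ℝ) ^ 2) := mul_le_mul_of_nonneg_left hdistN hC
    have a4 : E L (NL L) / (L : ℝ) ^ 2 ≤ e n + C * (2 / (L : ℝ) ^ 2) + ε / 4 := by linarith
    rw [div_le_iff₀ hL2pos] at a4
    have e1 : (e n + C * (2 / (L : ℝ) ^ 2) + ε / 4) * (L : ℝ) ^ 2 = (L : ℝ) ^ 2 * e n + 2 * C + ε / 4 * (L : ℝ) ^ 2 := by
      field_simp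
    linarith
  -- the right-hand side for `K ≤ L²`
  have hRHS : ∀ K' : ℕ, K' ≤ L ^ 2 → (L : ℝ) ^ 2 * e n - μ * (n * (L : ℝ) ^ 2) + μ * K' - ε / 4 * (L : ℝ) ^ 2 ≤
      E L K' := by
    intro K' hK'
    have hK'5 : 4 * K' ≤ 5 * L ^ 2 := by omega
    have hB := hL₁ L hLL₁ K' hK'5
    have hνK0 : 0 ≤ (K' : ℝ) / (L : ℝ) ^ 2 := by positivity
    have hνK1 : (K' : ℝ) / (L : ℝ) ^ 2 ≤ 5 / 4 := by
      rw [div_le_iff₀ hL2pos]; have : (K' : ℝ) ≤ (L : ℝ) ^ 2 := by exact_mod_cast hK'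
      linarith
    have hs := hsupp ((K' : ℝ) / (L : ℝ) ^ 2) ⟨hνK0, hνK1⟩
    change e n + μ * ((K' : ℝ) / (L : ℝ) ^ 2 - n) ≤ e ((K' : ℝ) / (L : ℝ) ^ 2) at hs
    have b1 := (abs_le.1 hB).1
    change -(ε / 4) ≤ E L K' / (L : ℝ) ^ 2 - e ((K' : ℝ) / (L : ℝ) ^ 2) at b1
    have b2 : e n + μ * ((K' : ℝ) / (L : ℝ) ^ 2 - n) - ε / 4 ≤ E L K' / (L : ℝ) ^ 2 := by linarith
    rw [le_div_iff₀ hL2pos] at b2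
    have e1 : (e n + μ * ((K' : ℝ) / (L : ℝ) ^ 2 - n) - ε / 4) * (L : ℝ) ^ 2 =
        (L : ℝ) ^ 2 * e n - μ * (n * (L : ℝ) ^ 2) + μ * K' - ε / 4 * (L : ℝ) ^ 2 := by
      field_simp
      ring
    linarith
  -- `−μ N_L ≤ −μ n L² + 2|μ|`
  have hμN : -μ * (NL L : ℝ) ≤ -μ * (n * (L : ℝ) ^ 2) + 2 * |μ| := by
    have h := abs_le.1 hNLr
    have : -μ * ((NL L : ℝ) - n * (L : ℝ) ^ 2) ≤ |μ| * 2 := by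
      calc -μ * ((NL L : ℝ) - n * (L : ℝ) ^ 2) ≤ |(-μ) * ((NL L : ℝ) - n * (L : ℝ) ^ 2)| := le_abs_self _
        _ = |μ| * |(NL L : ℝ) - n * (L : ℝ) ^ 2| := by rw [abs_mul, abs_neg]
        _ ≤ |μ| * 2 := mul_le_mul_of_nonneg_left hNLr (abs_nonneg μ)
    linarith
  have hR1L : 0 ≤ R * ((L : ℝ) + 1) := by positivity
  rcases le_or_gt K (L ^ 2) with hKs | hKb
  · -- `K ≤ L²`
    have hR1 := hRHS K hKs
    linarith [hLHS, hR1, hμN, hsmall, hR1L]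
  · -- `L² < K ≤ 2L²`: reflect to `K̃ = 2L² − K < L²`
    set Kt : ℕ := 2 * L ^ 2 - K with hKtdef
    have hKtle : Kt ≤ L ^ 2 := by omega
    have hR1 := hRHS Kt hKtle
    have href := hrefl L K hKb.le hK
    have hKtr : (Kt : ℝ) = 2 * (L : ℝ) ^ 2 - K := by
      rw [hKtdef, Nat.cast_sub hK]; push_cast; ring
    have hKtK : (Kt : ℝ) ≤ K := by
      have : ((L : ℝ)) ^ 2 < K := by exact_mod_cast hKb
      rw [hKtr]; linarith
    have hμK : μ * K ≤ μ * (Kt : ℝ) := mul_le_mul_of_nonpos_left hKtK hμ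
    linarith [hLHS, hR1, hμN, hsmall, href, hμK]

end Abstract

end Summit.HubbardSuperconductivity.HubbardSuperconductivity.Theorems

end
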